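import Summits.AtomisticToContinuum.FouriersLaw.Theorems.HeatModeWeylLawSpecificHeatLimitTransfer
import HarnessLib

/-!
# Transfer-operator identities for the Gibbs moments of bond energies

Helper file for item `stmt-AtomisticToContinuum-12398` (`SpecificHeatLimit`, route `HeatModeWeylLaw`
of `AtomisticToContinuum/FouriersLaw`); instances of `integral_insertions_eq_inner`
(`HeatModeWeylLawSpecificHeatLimitTransfer.lean`). Setting: an `OscillatorChain P`, `T ≠ 0`,
`a = e^{-U/4T}`, `ρ = a² dq` (finite), the symmetrised transfer kernel `k`, the symmetrised bond
energy `h`, and bounded operators `A`, `H₁`, `H₂` on `L²(ρ)` realising the kernels `k`, `k h`, `k h²`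
(all data enter through hypotheses; `b`, `bU` are `L²` vectors a.e. equal to `a`, `U² a`). For the
`(n+1)`-site chain with Boltzmann weight `w = e^{-Φ_{n+1}/T}`:

* `gibbsMoments_eq_inner` — `∫ w = ⟪b, Aⁿ b⟫` (partition function),
  `∫ h(qᵢ, qᵢ₊₁) w = ⟪b, Aⁱ H₁ A^{n-1-i} b⟫`, `∫ hᵢ hⱼ w = ⟪b, Aⁱ H₁ A^{j-i-1} H₁ A^{n-1-j} b⟫` (`i < j`),
  `∫ hᵢ² w = ⟪b, Aⁱ H₂ A^{n-1-i} b⟫`, `∫ U(q₀)² w = ⟪bU, Aⁿ b⟫`, `∫ U(qₙ)² w = ⟪b, Aⁿ bU⟫`;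
* `listProd_one_insertion`, `listProd_two_insertions` — the operator words;
* `toLp_eq_of_ae_eq` — bookkeeping.

All [folklore]; no definitions.
-/

noncomputable section

open MeasureTheory Set Filter Function
open scoped RealInnerProductSpace ENNReal

namespace Summit.AtomisticToContinuum.FouriersLaw.Theorems.SpecificHeatLimit

open Literature.MathematicalPhysics.KineticTheory.HeatConduction Literature.Analysis.OperatorTheory

/-! ### Operator words with one or two insertions -/

/-- The word with one insertion: `∏_{t<n} (t = i ? H : A) = Aⁱ H A^{n-1-i}` (`i < n`). [folklore] -/
theorem listProd_one_insertion {M : Type*} [Monoid M] (A H : M) {i n : ℕ} (hi : i < n) :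
    ((List.range n).map fun t => if t = i then H else A).prod = A ^ i * H * A ^ (n - 1 - i) := by
  set Op : ℕ → M := fun t => if t = i then H else A with hOp
  obtain ⟨r, rfl⟩ : ∃ r, n = i + 1 + r := ⟨n - i - 1, by omega⟩
  have h1 : ((List.range (0 + i)).map Op).prod = ((List.range 0).map Op).prod * A ^ i :=
    listProd_map_range_of_eq Op A 0 i fun t _ ht => by rw [hOp]; dsimp only; rw [if_neg (by omega)]
  have h2 : ((List.range (i + 1)).map Op).prod = ((List.range i).map Op).prod * H ^ 1 :=
    listProd_map_range_of_eq Op H i 1 fun t h1 h2 => by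
      rw [hOp]; dsimp only; rw [if_pos (by omega)]
  have h3 : ((List.range (i + 1 + r)).map Op).prod = ((List.range (i + 1)).map Op).prod * A ^ r :=
    listProd_map_range_of_eq Op A (i + 1) r fun t h1 _ => by
      rw [hOp]; dsimp only; rw [if_neg (by omega)]
  rw [Nat.zero_add, List.range_zero, List.map_nil, List.prod_nil, one_mul] at h1
  rw [h3, h2, h1, pow_one, show i + 1 + r - 1 - i = r by omega]

/-- The word with two insertions:
`∏_{t<n} (t ∈ {i, j} ? H : A) = Aⁱ H A^{j-i-1} H A^{n-1-j}` (`i < j < n`). [folklore] -/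
theorem listProd_two_insertions {M : Type*} [Monoid M] (A H : M) {i j n : ℕ} (hij : i < j)
    (hj : j < n) :
    ((List.range n).map fun t => if t = i ∨ t = j then H else A).prod =
      A ^ i * H * A ^ (j - i - 1) * H * A ^ (n - 1 - j) := by
  set Op : ℕ → M := fun t => if t = i ∨ t = j then H else A with hOp
  obtain ⟨g, rfl⟩ : ∃ g, j = i + 1 + g := ⟨j - i - 1, by omega⟩
  obtain ⟨r, rfl⟩ : ∃ r, n = i + 1 + g + 1 + r := ⟨n - (i + 1 + g) - 1, by omega⟩
  have h1 : ((List.range (0 + i)).map Op).prod = ((List.range 0).map Op).prod * A ^ i :=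
    listProd_map_range_of_eq Op A 0 i fun t _ ht => by rw [hOp]; dsimp only; rw [if_neg (by omega)]
  have h2 : ((List.range (i + 1)).map Op).prod = ((List.range i).map Op).prod * H ^ 1 :=
    listProd_map_range_of_eq Op H i 1 fun t h1 h2 => by
      rw [hOp]; dsimp only; rw [if_pos (by omega)]
  have h3 : ((List.range (i + 1 + g)).map Op).prod = ((List.range (i + 1)).map Op).prod * A ^ g :=
    listProd_map_range_of_eq Op A (i + 1) g fun t h1 h2 => by
      rw [hOp]; dsimp only; rw [if_neg (by omega)]
  have h4 : ((List.range (i + 1 + g + 1)).map Op).prod = ((List.range (i + 1 + g)).map Op).prod * H ^ 1 :=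
    listProd_map_range_of_eq Op H (i + 1 + g) 1 fun t h1 h2 => by
      rw [hOp]; dsimp only; rw [if_pos (by omega)]
  have h5 : ((List.range (i + 1 + g + 1 + r)).map Op).prod =
      ((List.range (i + 1 + g + 1)).map Op).prod * A ^ r :=
    listProd_map_range_of_eq Op A (i + 1 + g + 1) r fun t h1 _ => by
      rw [hOp]; dsimp only; rw [if_neg (by omega)]
  rw [Nat.zero_add, List.range_zero, List.map_nil, List.prod_nil, one_mul] at h1
  rw [h5, h4, h3, h2, h1, pow_one, show i + 1 + g - i - 1 = g by omega,
    show i + 1 + g + 1 + r - 1 - (i + 1 + g) = r by omega]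

/-! ### The identities -/

section Identities

variable {P : OscillatorChain} {T : ℝ} {a : ℝ → ℝ} {k h : ℝ → ℝ → ℝ} {ρ : Measure ℝ}
  [IsFiniteMeasure ρ] {A H₁ H₂ : Lp ℝ 2 ρ →L[ℝ] Lp ℝ 2 ρ} {b bU : Lp ℝ 2 ρ} {C : ℝ}

/-- Bookkeeping: an `L²` vector a.e. equal to a bounded measurable function is its class.
[folklore] -/
theorem toLp_eq_of_ae_eq {f : ℝ → ℝ} (hf : Measurable f) {B : ℝ} (hfb : ∀ x, ‖f x‖ ≤ B)
    {v : Lp ℝ 2 ρ} (hv : (v : ℝ → ℝ) =ᵐ[ρ] f) : (memLp_two_of_bound (μ := ρ) hf hfb).toLp f = v :=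
  Lp.ext ((memLp_two_of_bound (μ := ρ) hf hfb).coeFn_toLp.trans hv.symm)

/-- **The Gibbs moments of the bond energies in transfer-operator form.** Hypotheses: `T ≠ 0`,
`a = e^{-U/4T}` bounded by `1` with `U` measurable, `ρ = a² dq` finite, the kernel
`k(q, q') = a(q) e^{-V(q'-q)/T} a(q')`, jointly measurable kernels `k`, `k h`, `k h²` bounded by `C` with
`L²(ρ)` realisations `A, H₁, H₂`, boundary vectors `b =ᵐ a`, `bU =ᵐ U² a` (`U² a` bounded by `C`).
Conclusions, for the `(n+1)`-site chain with `w = e^{-Φ_{n+1}/T}`: (Z) `∫ w = ⟪b, Aⁿ b⟫`;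
(S1) `∫ h(qᵢ, qᵢ₊₁) w = ⟪b, Aⁱ H₁ A^{n-1-i} b⟫`; (S2) `∫ hᵢ hⱼ w = ⟪b, Aⁱ H₁ A^{j-i-1} H₁ A^{n-1-j} b⟫`
(`i < j`); (S2d) `∫ hᵢ² w = ⟪b, Aⁱ H₂ A^{n-1-i} b⟫`; (B) `∫ U(q₀)² w = ⟪bU, Aⁿ b⟫`,
`∫ U(qₙ)² w = ⟪b, Aⁿ bU⟫`. [folklore] -/
theorem gibbsMoments_eq_inner (hT : T ≠ 0) (ha : ∀ x, a x = Real.exp (-P.U x / (4 * T)))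
    (hUm : Measurable P.U) (hab : ∀ x, ‖a x‖ ≤ 1)
    (hk : ∀ x y, k x y = a x * Real.exp (-P.V (y - x) / T) * a y)
    (hρ : ρ = volume.withDensity fun x => ENNReal.ofReal (a x ^ 2))
    (hkm : Measurable (uncurry k)) (hkb : ∀ x y, ‖k x y‖ ≤ C)
    (hkhm : Measurable (uncurry fun x y => k x y * h x y)) (hkhb : ∀ x y, ‖k x y * h x y‖ ≤ C)
    (hkh2m : Measurable (uncurry fun x y => k x y * h x y ^ 2))
    (hkh2b : ∀ x y, ‖k x y * h x y ^ 2‖ ≤ C)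
    (hA : ∀ ψ : Lp ℝ 2 ρ, (A ψ : ℝ → ℝ) =ᵐ[ρ] fun x => ∫ y, k x y * ψ y ∂ρ)
    (hH₁ : ∀ ψ : Lp ℝ 2 ρ, (H₁ ψ : ℝ → ℝ) =ᵐ[ρ] fun x => ∫ y, (k x y * h x y) * ψ y ∂ρ)
    (hH₂ : ∀ ψ : Lp ℝ 2 ρ, (H₂ ψ : ℝ → ℝ) =ᵐ[ρ] fun x => ∫ y, (k x y * h x y ^ 2) * ψ y ∂ρ)
    (hb : (b : ℝ → ℝ) =ᵐ[ρ] a) (hUab : ∀ x, ‖P.U x ^ 2 * a x‖ ≤ C)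
    (hbU : (bU : ℝ → ℝ) =ᵐ[ρ] fun x => P.U x ^ 2 * a x) (n : ℕ) :
    -- (Z)
    (∫ q : Fin (n + 1) → ℝ, Real.exp (-P.potential (n + 1) q / T) = ⟪b, (A ^ n) b⟫) ∧
    -- (S1)
    (∀ i : Fin n, ∫ q : Fin (n + 1) → ℝ, h (q (Fin.castSucc i)) (q i.succ) *
        Real.exp (-P.potential (n + 1) q / T) = ⟪b, (A ^ (i : ℕ)) (H₁ ((A ^ (n - 1 - i)) b))⟫) ∧
    -- (S2)
    (∀ i j : Fin n, (i : ℕ) < j → ∫ q : Fin (n + 1) → ℝ, h (q (Fin.castSucc i)) (q i.succ) *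
        h (q (Fin.castSucc j)) (q j.succ) * Real.exp (-P.potential (n + 1) q / T) =
        ⟪b, (A ^ (i : ℕ)) (H₁ ((A ^ ((j : ℕ) - i - 1)) (H₁ ((A ^ (n - 1 - j)) b))))⟫) ∧
    -- (S2d)
    (∀ i : Fin n, ∫ q : Fin (n + 1) → ℝ, h (q (Fin.castSucc i)) (q i.succ) ^ 2 *
        Real.exp (-P.potential (n + 1) q / T) = ⟪b, (A ^ (i : ℕ)) (H₂ ((A ^ (n - 1 - i)) b))⟫) ∧
    -- (B0), (Bn)
    (∫ q : Fin (n + 1) → ℝ, P.U (q 0) ^ 2 * Real.exp (-P.potential (n + 1) q / T) = ⟪bU, (A ^ n) b⟫) ∧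
    (∫ q : Fin (n + 1) → ℝ, P.U (q (Fin.last n)) ^ 2 * Real.exp (-P.potential (n + 1) q / T) =
        ⟪b, (A ^ n) bU⟫) := by
  -- measurability / bounds of the boundary functions
  have ham : Measurable a := by
    have : a = fun x => Real.exp (-P.U x / (4 * T)) := funext ha
    rw [this]; exact Real.measurable_exp.comp ((hUm.neg).div_const _)
  have h1am : Measurable fun x => (1 : ℝ) * a x := by simpa only [one_mul] using ham
  have h1ab : ∀ x, ‖(1 : ℝ) * a x‖ ≤ 1 := fun x => by rw [one_mul]; exact hab x
  have hUam : Measurable fun x => P.U x ^ 2 * a x := (hUm.pow_const 2).mul ham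
  have hb1 : (memLp_two_of_bound (μ := ρ) h1am h1ab).toLp _ = b :=
    toLp_eq_of_ae_eq h1am h1ab (hb.trans (Eventually.of_forall fun x => (one_mul _).symm))
  have hbU1 : (memLp_two_of_bound (μ := ρ) hUam hUab).toLp _ = bU := toLp_eq_of_ae_eq hUam hUab hbU
  -- the kernel of `A` in the form `k x y * 1`
  have hA' : ∀ ψ : Lp ℝ 2 ρ, (A ψ : ℝ → ℝ) =ᵐ[ρ] fun x => ∫ y, (k x y * 1) * ψ y ∂ρ := by
    intro ψ; simpa only [mul_one] using hA ψ
  have hk1m : Measurable (uncurry fun x y => k x y * (1 : ℝ)) := by simpa only [mul_one] using hkm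
  have hk1b : ∀ x y, ‖k x y * (1 : ℝ)‖ ≤ C := fun x y => by rw [mul_one]; exact hkb x y
  -- the generic identity with an insertion family
  have key := fun (m : ℕ → ℝ → ℝ → ℝ) (Op : ℕ → (Lp ℝ 2 ρ →L[ℝ] Lp ℝ 2 ρ))
      (hKm : ∀ t, Measurable (uncurry fun x y => k x y * m t x y))
      (hKb : ∀ t x y, ‖k x y * m t x y‖ ≤ C)
      (hOp : ∀ t (ψ : Lp ℝ 2 ρ), (Op t ψ : ℝ → ℝ) =ᵐ[ρ] fun x => ∫ y, (k x y * m t x y) * ψ y ∂ρ)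
      {f g : ℝ → ℝ} (hf : Measurable fun x => f x * a x) {Bf : ℝ} (hfb : ∀ x, ‖f x * a x‖ ≤ Bf)
      (hg : Measurable fun x => g x * a x) {Bg : ℝ} (hgb : ∀ x, ‖g x * a x‖ ≤ Bg) =>
    integral_insertions_eq_inner P n hT ha hUm hk hρ hKm hKb hOp hf hfb hg hgb
  refine ⟨?_, fun i => ?_, fun i j hij => ?_, fun i => ?_, ?_, ?_⟩
  · -- (Z): no insertion
    have hres := key (fun _ _ _ => 1) (fun _ => A) (fun _ => hk1m) (fun _ => hk1b) (fun _ => hA')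
      h1am h1ab h1am h1ab
    have hw : ((List.range n).map fun _ : ℕ => A).prod = A ^ n := by
      rw [List.map_const', List.prod_replicate, List.length_range]
    rw [hb1] at hres
    simp only [Finset.prod_const_one, mul_one, one_mul, hw] at hres
    exact hres
  · -- (S1): one insertion of `h` at bond `i`
    have hres := key (fun t x y => if t = (i : ℕ) then h x y else 1)
      (fun t => if t = (i : ℕ) then H₁ else A) (fun t => ?_) (fun t x y => ?_) (fun t ψ => ?_)
      h1am h1ab h1am h1ab
    rotate_left
    · by_cases ht : t = (i : ℕ)
      · simp only [ht, if_true]; exact hkhm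
      · simp only [ht, if_false]; exact hk1m
    · by_cases ht : t = (i : ℕ)
      · simp only [ht, if_true]; exact hkhb x y
      · simp only [ht, if_false]; exact hk1b x y
    · by_cases ht : t = (i : ℕ)
      · simp only [ht, if_true]; exact hH₁ ψ
      · simp only [ht, if_false]; exact hA' ψ
    have hprod : ∀ q : Fin (n + 1) → ℝ,
        (∏ t : Fin n, if (t : ℕ) = (i : ℕ) then h (q (Fin.castSucc t)) (q t.succ) else 1) =
          h (q (Fin.castSucc i)) (q i.succ) := by
      intro q
      rw [Finset.prod_eq_single i]
      · rw [if_pos rfl]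
      · intro t _ hti
        rw [if_neg (fun e => hti (Fin.ext e))]
      · intro hi; exact absurd (Finset.mem_univ i) hi
    rw [hb1] at hres
    simp only [hprod, one_mul, mul_one, listProd_one_insertion A H₁ i.isLt, mul_apply_eq_comp] at hres
    simpa only [one_mul] using hres
  · -- (S2): two insertions of `h` at bonds `i < j`
    have hres := key (fun t x y => if t = (i : ℕ) ∨ t = (j : ℕ) then h x y else 1)
      (fun t => if t = (i : ℕ) ∨ t = (j : ℕ) then H₁ else A) (fun t => ?_) (fun t x y => ?_)
      (fun t ψ => ?_) h1am h1ab h1am h1ab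
    rotate_left
    · by_cases ht : t = (i : ℕ) ∨ t = (j : ℕ)
      · simp only [ht, if_true]; exact hkhm
      · simp only [ht, if_false]; exact hk1m
    · by_cases ht : t = (i : ℕ) ∨ t = (j : ℕ)
      · simp only [ht, if_true]; exact hkhb x y
      · simp only [ht, if_false]; exact hk1b x y
    · by_cases ht : t = (i : ℕ) ∨ t = (j : ℕ)
      · simp only [ht, if_true]; exact hH₁ ψ
      · simp only [ht, if_false]; exact hA' ψ
    have hij' : i ≠ j := fun e => by rw [e] at hij; exact lt_irrefl _ hij
    have hprod : ∀ q : Fin (n + 1) → ℝ,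
        (∏ t : Fin n, if (t : ℕ) = (i : ℕ) ∨ (t : ℕ) = (j : ℕ) then h (q (Fin.castSucc t)) (q t.succ)
          else 1) = h (q (Fin.castSucc i)) (q i.succ) * h (q (Fin.castSucc j)) (q j.succ) := by
      intro q
      rw [← Finset.prod_filter, show (Finset.univ.filter fun t : Fin n =>
        (t : ℕ) = (i : ℕ) ∨ (t : ℕ) = (j : ℕ)) = {i, j} by
          ext t; simp [Fin.ext_iff], Finset.prod_pair hij']
    rw [hb1] at hres
    simp only [hprod, one_mul, mul_one, listProd_two_insertions A H₁ hij j.isLt, mul_apply_eq_comp]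
      at hres
    simpa only [one_mul, mul_assoc] using hres
  · -- (S2d): one insertion of `h²` at bond `i`
    have hres := key (fun t x y => if t = (i : ℕ) then h x y ^ 2 else 1)
      (fun t => if t = (i : ℕ) then H₂ else A) (fun t => ?_) (fun t x y => ?_) (fun t ψ => ?_)
      h1am h1ab h1am h1ab
    rotate_left
    · by_cases ht : t = (i : ℕ)
      · simp only [ht, if_true]; exact hkh2m
      · simp only [ht, if_false]; exact hk1m
    · by_cases ht : t = (i : ℕ)
      · simp only [ht, if_true]; exact hkh2b x y
      · simp only [ht, if_false]; exact hk1b x y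
    · by_cases ht : t = (i : ℕ)
      · simp only [ht, if_true]; exact hH₂ ψ
      · simp only [ht, if_false]; exact hA' ψ
    have hprod : ∀ q : Fin (n + 1) → ℝ,
        (∏ t : Fin n, if (t : ℕ) = (i : ℕ) then h (q (Fin.castSucc t)) (q t.succ) ^ 2 else 1) =
          h (q (Fin.castSucc i)) (q i.succ) ^ 2 := by
      intro q
      rw [Finset.prod_eq_single i]
      · rw [if_pos rfl]
      · intro t _ hti
        rw [if_neg (fun e => hti (Fin.ext e))]
      · intro hi; exact absurd (Finset.mem_univ i) hi
    rw [hb1] at hres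
    simp only [hprod, one_mul, mul_one, listProd_one_insertion A H₂ i.isLt, mul_apply_eq_comp] at hres
    simpa only [one_mul] using hres
  · -- (B0): `U(q₀)²` at the left boundary
    have hres := key (fun _ _ _ => 1) (fun _ => A) (fun _ => hk1m) (fun _ => hk1b) (fun _ => hA')
      hUam hUab h1am h1ab
    have hw : ((List.range n).map fun _ : ℕ => A).prod = A ^ n := by
      rw [List.map_const', List.prod_replicate, List.length_range]
    rw [hb1, hbU1] at hres
    simp only [Finset.prod_const_one, mul_one, hw] at hres
    exact hres
  · -- (Bn): `U(qₙ)²` at the right boundary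
    have hres := key (fun _ _ _ => 1) (fun _ => A) (fun _ => hk1m) (fun _ => hk1b) (fun _ => hA')
      h1am h1ab hUam hUab
    have hw : ((List.range n).map fun _ : ℕ => A).prod = A ^ n := by
      rw [List.map_const', List.prod_replicate, List.length_range]
    rw [hb1, hbU1] at hres
    simp only [Finset.prod_const_one, mul_one, one_mul, hw] at hres
    exact hres

end Identities

end Summit.AtomisticToContinuum.FouriersLaw.Theorems.SpecificHeatLimit

end
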